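import Literature.MathematicalPhysics.QuantumLattice.HubbardTTPrimeDiagHopTransportThermal
import HarnessLib

/-!
# Cap-class certificate transport across a `t'`-cell from the FAR column at positive temperature:
# the anchor energy of every THERMAL torus limit of the cell is below the far column's `T = 0` tangent
# at the anchor plus the entropy price `T·s_max(n)`

Family `hubbard` (topic `MathematicalPhysics/QuantumLattice`); written for stage S2 of the Hubbard
material-oracle programme (cell `pub/hubbard-downfold`, seat `hubbard-downfold-unc-3`: the `t'`-direction
robustness rows by which a parameter BOX maps to a certified word), on the standing offer of seat
`hubbard-box-p3` to port its `T = 0` file `HubbardTTPrimeTwoColumnCapTransport` to the thermal state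
class. The `T > 0` twin of that file and the two-column companion of
`HubbardTTPrimeDiagHopTransportThermal` §6 (ONE capped anchor: booking
`u₀ + 2H_b(n/2)/β + |s − s₀|·(A − B)`, kinematic `e(s₀) + 2H_b(n/2)/β + (32/π²)|s − s₀|`).

State class = the tree's TORUS-LIMIT THERMAL CONVENTION (`TorusSectorGibbsMixture`): "thermal torus limit
at `(β, s)`" = a torus limit `ω` (`InfVolFermionState.IsTorusLimitOfMixture`) of the canonical Gibbs states
`e^{-βH_L(t,s,U)|_sec}/Z` on the `(rectN n L, S^z = 0)` sectors along some `Ls → ∞`. Notation as in the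
companions: `e(t,t',U,n) = energyDensityTT' t t' U n`; `Φ(t,t',U) = hubbardTTPrimeFermionInteraction t t' U`;
`e_Φ(ω) = ω.meanEnergy Φ 1`; `K₂(ω) = e_{Φ(0,1,0)}(ω)` (`= −HOP2`); `H_b` = `Real.binEntropy`, so
`2H_b(n/2) = s_max(n)`; GROUND-STATE ceiling word `A₁` at `s₁`: `K₂(ω₁) ≤ A₁` for every torus-limit ground
state at `(t,s₁,U)`; THERMAL ceiling word `A₁'` at `(β, s₁)`: `K₂(ω₁) ≤ A₁'` for every thermal torus limit
at `(β, s₁)`; floor words `B₂` (ground states at `s₂`), `B₂'` (thermal at `(β, s₂)`) likewise.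

THE POINT. A certificate solved at an anchor `s₀` whose state hypotheses are an energy CAP
`e_{Φ(t,s₀,U)}(ω) ≤ u` plus state-independent rows (cut / positivity / translation invariance / kinematic
rows — all valid for torus limits of probability MIXTURES of unit `rectN n`-vectors, so the same
certificate serves `T = 0` and `T > 0`) speaks about a thermal torus limit `ω` at another `(β, s)` as soon
as `e_{Φ(t,s₀,U)}(ω) ≤ u` is certified. By linearity and the energy–entropy cap of the convention,
`e_{Φ(t,s₀,U)}(ω) = e_{Φ(t,s,U)}(ω) + (s₀ − s)·K₂(ω) ≤ e(t,s,U,n) + 2H_b(n/2)/β + (s₀ − s)·K₂(ω)`.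
The first term is the `T = 0` energy density, capped by the FAR COLUMN's tangent (its certified cap and
ground-state `K₂` word, exactly as at `T = 0`); the last term is priced by a THERMAL `K₂` word at the far
column, moved across the cell by the `t'`-antitonicity of the thermal `K₂`
(`HubbardTTPrimeDiagHopTransportThermal` §5), or by the kinematic row `|K₂| ≤ 16/π²`.

* §1 (fixed `β`, words) `IsTorusLimitOfMixture.meanEnergy_anchor_le_of_leftColumn_pointwise_of_sectorGibbs`:
  for `s₁ ≤ s ≤ s₀`, `e_{Φ(t,s₀,U)}(ω) ≤ R₁ + (s − s₁)A₁ + (s₀ − s)A₁' + 2H_b(n/2)/β`; uniformly in `s`,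
  `≤ R₁ + (s₀ − s₁)·max A₁ A₁' + 2H_b(n/2)/β` (`…_leftColumn_of_sectorGibbs`); right column
  `≤ R₂ − (s₂ − s)B₂ − (s − s₀)B₂' + 2H_b(n/2)/β ≤ R₂ − (s₂ − s₀)·min B₂ B₂' + 2H_b(n/2)/β`; both sides
  (`…_outerColumns_of_sectorGibbs`) and the window form with the cut-row floor `e(t,s₀,U,n)`. A cap-class
  certificate for mixtures at the column gives BOTH words (`A₁ = A₁'`), and then the bound is LITERALLY the
  `T = 0` bound plus `2H_b(n/2)/β`.
* §2 (word-free) `…_of_leftCap_kinematic_of_sectorGibbs`, `…_of_rightCap_kinematic_of_sectorGibbs`,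
  `…_of_outerCaps_kinematic_of_sectorGibbs`: `≤ R_far + (16/π²)·gap + 2H_b(n/2)/β` — HALF the one-anchor
  kinematic price `32/π²`, no cap at the anchor, and (the entropy term being antitone in `β`) valid on the
  whole `(cell) × (T ≤ 1/β)`.
* §3 BOX ⇒ WORD in the thermal cap class (the hypothesis shape of
  `forall_sectorGibbsLimit_tPrime_box_of_forall_cap`): `forall_sectorGibbsLimit_tPrime_cell_of_forall_cap_leftColumn`
  (`R₁ + (s₀ − s₁)·max A₁ A₁' + 2H_b(n/2)/β ≤ u` books `[s₁, s₀]` at `β`), `…_rightColumn`, `…_outerColumns`,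
  and over a temperature RANGE `…_outerCaps_kinematic` / `…_leftCap_kinematic` / `…_rightCap_kinematic`
  (`max (R₁ + (16/π²)(s₀ − s₁)) (R₂ + (16/π²)(s₂ − s₀)) + 2H_b(n/2)/β ≤ u` books `[s₁, s₂] × (T ≤ 1/β)`).
* §4 the `κ`-priced twins for words with explicit cap slack `c + κ(u₀ − e_{Φ(t,s₀,U)}(ω)) ≤ f ω`
  (`IsTorusLimitOfMixture.sub_mul_le_word_of_forall_capSlack_leftColumn_of_sectorGibbs`, `…_rightColumn…`,
  `…_outerColumns…`, `…_outerCaps_kinematic…`): the word degrades by `κ·(booking − u₀)`.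

HONEST FRAMING: bookkeeping of linearity in `t'`, the energy–entropy cap of the torus-limit thermal
convention, the Hellmann–Feynman tangents of the concave `t' ↦ e` and the antitonicity of the thermal `K₂`
in `t'` at fixed `β`; thermal `K₂` words do not move in `β` (no monotonicity), which is why the
temperature-range cells are the kinematic ones; no number is produced here, every cap and word is a
hypothesis to be discharged by a certified row, and nothing here bears on superconductivity by itself.
Everything is PROVED; no definition, no named fact, no numerical input. WHAT THIS IS NOT: no certificate,
no phase sentence — transport lemmas (the certified side of the SYSTEMATIC → CERTIFIED seam) only.

## Mathlib / tree search

REUSED (not restated): `InfVolFermionState.meanEnergy_hubbardTTPrime_affine`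
(`HubbardTTPrimeMeanEnergySupergradient`), the thermal convention's rows
`IsTorusLimitOfMixture.meanEnergy_hubbardTTPrime_le_energyDensityTT'_add_binEntropy_div`,
`…energyDensityTT'_le_meanEnergy_of_sectorGibbs`, `…abs_meanEnergy_diagHop_le_of_sectorGibbs`,
`sectorGibbsWeightTT'_nonneg`, `sum_sectorGibbsWeightTT'`, `isNParticle_sectorGibbsVectorTT'`,
`star_sectorGibbsVectorTT'_dotProduct_self` (`TorusSectorGibbsMixture`), the thermal `t'`-transport rows
`IsTorusLimitOfMixture.meanEnergy_diagHop_le_of_forall_left_of_sectorGibbs`,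
`…le_meanEnergy_diagHop_of_forall_right_of_sectorGibbs` (`HubbardTTPrimeDiagHopTransportThermal` §5), the
`T = 0` tangents `energyDensityTT'_sub_le_mul_of_forall_diagHop_le`,
`mul_le_energyDensityTT'_sub_of_forall_le_diagHop`, `energyDensityTT'_le_of_upperBound_tPrime_kinematic`
(`HubbardTTPrimeDiagHopTransport` §5). `lean search 'Column.*sectorGibbs|cell_of_forall_cap.*sectorGibbs|
Caps_kinematic.*sectorGibbs' --decl`: nothing — the thermal convention had the one-anchor rule only
(`HubbardTTPrimeDiagHopTransportThermal` §6); the `T = 0` two-column rule is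
`HubbardTTPrimeTwoColumnCapTransport` (seat `hubbard-box-p3`), whose statements are mirrored here name by name
with the suffix `_of_sectorGibbs`.

## References

* R. B. Israel, *Convexity in the Theory of Lattice Gases*, Princeton (1979), Lemma II.3.1 (finite-volume
  variational principle: energy–entropy balance of Gibbs states) and Thm. I.3.4 (tangent functionals are
  global affine majorants). [cite: Israel1979, Lemma II.3.1]
* T. Koma, H. Tasaki, J. Stat. Phys. 76 (1994) 745, §1 (the conjugate observable is a supergradient of
  the concave ground-state energy in a linear coupling). [cite: KomaTasaki1994, §1]
* E. H. Lieb, Commun. Math. Phys. 31 (1973) 327, §V (5.2)–(5.4) (Peierls–Bogoliubov brackets: the thermal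
  conjugate expectation is monotone in the coupling). [cite: Lieb1973, §V (5.2)–(5.4)]
* J. Wang et al., *Certifying ground-state properties of many-body systems*, Phys. Rev. X 14 (2024)
  031006, §III (a relaxation certificate constrains every state below an energy cap). [cite: WangEtAl2024, §III]
* E. H. Lieb, M. Loss, Duke Math. J. 71 (1993) 337, §8 Thm. 8.2 (`|K₂| ≤ 16/π²`).
  [cite: LiebLoss1993, §8, Theorem 8.2]
-/

noncomputable section

namespace Literature.MathematicalPhysics.QuantumLattice

open Matrix Finset HubbardWave0 Literature.Probability.LatticeModels ThermodynamicLimit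
open _root_.Filter
open scoped _root_.Topology ComplexOrder BigOperators

namespace InfVolFermionState

/-! ### §1 The anchor energy of a thermal torus limit of the cell from the far column's cap and words
(fixed `β`: a ground-state word prices the `T = 0` tangent, a thermal word prices `K₂(ω)`) -/

/-- **Thermal anchor energy from the LEFT column, pointwise in `s`.** For `s₁ ≤ s ≤ s₀` (same `t`,
`U ≥ 0`, density `0 ≤ n < 2`, `β > 0`), a certified cap `e(t,s₁,U,n) ≤ R₁`, a ground-state ceiling word
`A₁` at `s₁` and a THERMAL ceiling word `A₁'` at `(β, s₁)`: every thermal torus limit `ω` at `(β, s)` has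
`e_{Φ(t,s₀,U)}(ω) ≤ R₁ + (s − s₁)·A₁ + (s₀ − s)·A₁' + 2H_b(n/2)/β` (linearity
`e_{Φ(t,s₀,U)}(ω) = e_{Φ(t,s,U)}(ω) + (s₀ − s)K₂(ω)`, the energy–entropy cap `e_{Φ(t,s,U)}(ω) ≤ e(t,s,U,n)
+ 2H_b(n/2)/β`, the column's tangent `e(t,s,U,n) ≤ R₁ + A₁(s − s₁)`, and `K₂(ω) ≤ A₁'` by the
`t'`-antitonicity of the thermal `K₂`). No data at the anchor is used.
[cite: Israel1979, Lemma II.3.1] [cite: KomaTasaki1994, §1] [cite: Lieb1973, §V (5.2)–(5.4)] -/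
theorem IsTorusLimitOfMixture.meanEnergy_anchor_le_of_leftColumn_pointwise_of_sectorGibbs (t : ℝ)
    {s₁ s s₀ : ℝ} (hs₁ : s₁ ≤ s) (hs₀ : s ≤ s₀) {U : ℝ} (hU : 0 ≤ U) {n : ℝ} (hn0 : 0 ≤ n)
    (hn2 : n < 2) {β : ℝ} (hβ : 0 < β) {R₁ A₁ A₁' : ℝ}
    (hR₁ : energyDensityTT' t s₁ U n ≤ R₁)
    (hA₁ : ∀ (ω₁ : InfVolFermionState 2) (Ls₁ : ℕ → ℕ) (ψ₁ : ∀ L, Fock (Orb (FermionTorus 2 L))),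
      Tendsto Ls₁ atTop atTop →
      (∀ j, IsGroundStateInSector (hubbardTorusTT' (Ls₁ j) t s₁ U) (rectN n (Ls₁ j)) 0 (ψ₁ (Ls₁ j))) →
      (∀ j, star (ψ₁ (Ls₁ j)) ⬝ᵥ ψ₁ (Ls₁ j) = 1) → ω₁.IsTorusLimitOf ψ₁ Ls₁ →
      ω₁.meanEnergy (hubbardTTPrimeFermionInteraction 0 1 0) 1 ≤ A₁)
    (hA₁' : ∀ (ω₁ : InfVolFermionState 2) (Ls₁ : ℕ → ℕ), Tendsto Ls₁ atTop atTop →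
      ω₁.IsTorusLimitOfMixture (sectorGibbsCount n) (fun L => sectorGibbsWeightTT' β t s₁ U n L)
        (fun L => sectorGibbsVectorTT' t s₁ U n L) Ls₁ →
      ω₁.meanEnergy (hubbardTTPrimeFermionInteraction 0 1 0) 1 ≤ A₁')
    {ω : InfVolFermionState 2} {Ls : ℕ → ℕ}
    (h : ω.IsTorusLimitOfMixture (sectorGibbsCount n) (fun L => sectorGibbsWeightTT' β t s U n L)
      (fun L => sectorGibbsVectorTT' t s U n L) Ls) (hLs : Tendsto Ls atTop atTop) :
    ω.meanEnergy (hubbardTTPrimeFermionInteraction t s₀ U) 1 ≤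
      R₁ + (s - s₁) * A₁ + (s₀ - s) * A₁' + 2 * Real.binEntropy (n / 2) / β := by
  have haff := ω.meanEnergy_hubbardTTPrime_affine t s U s₀ U
  rw [sub_self, zero_mul, add_zero] at haff
  have hcap := h.meanEnergy_hubbardTTPrime_le_energyDensityTT'_add_binEntropy_div t s hU hn0 hn2 hβ hLs
  have hup := energyDensityTT'_sub_le_mul_of_forall_diagHop_le t (le_refl s₁) hs₁ hU hn0 hn2 hA₁
  have hK := h.meanEnergy_diagHop_le_of_forall_left_of_sectorGibbs hn0 hn2.le hβ hs₁ hA₁' hLs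
  have hprod := mul_le_mul_of_nonneg_left hK (sub_nonneg.2 hs₀)
  rw [haff]
  have e : (s - s₁) * A₁ = A₁ * (s - s₁) := mul_comm _ _
  rw [e]
  linarith

/-- **Thermal anchor energy from the LEFT column** (uniform in `s`): for `s₁ ≤ s ≤ s₀`, a cap `R₁`, a
ground-state ceiling word `A₁` at `s₁` and a thermal ceiling word `A₁'` at `(β, s₁)` give
`e_{Φ(t,s₀,U)}(ω) ≤ R₁ + (s₀ − s₁)·max A₁ A₁' + 2H_b(n/2)/β` for every thermal torus limit `ω` at `(β, s)`.
With one word serving both roles (`A₁ = A₁'`, e.g. a cap-class certificate for mixtures at the column)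
this is the `T = 0` bound `R₁ + (s₀ − s₁)A₁` of `IsTorusLimitOf.meanEnergy_anchor_le_of_leftColumn` plus
the entropy price. [cite: Israel1979, Lemma II.3.1] [cite: KomaTasaki1994, §1] [cite: Lieb1973, §V (5.2)–(5.4)] -/
theorem IsTorusLimitOfMixture.meanEnergy_anchor_le_of_leftColumn_of_sectorGibbs (t : ℝ)
    {s₁ s s₀ : ℝ} (hs₁ : s₁ ≤ s) (hs₀ : s ≤ s₀) {U : ℝ} (hU : 0 ≤ U) {n : ℝ} (hn0 : 0 ≤ n)
    (hn2 : n < 2) {β : ℝ} (hβ : 0 < β) {R₁ A₁ A₁' : ℝ}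
    (hR₁ : energyDensityTT' t s₁ U n ≤ R₁)
    (hA₁ : ∀ (ω₁ : InfVolFermionState 2) (Ls₁ : ℕ → ℕ) (ψ₁ : ∀ L, Fock (Orb (FermionTorus 2 L))),
      Tendsto Ls₁ atTop atTop →
      (∀ j, IsGroundStateInSector (hubbardTorusTT' (Ls₁ j) t s₁ U) (rectN n (Ls₁ j)) 0 (ψ₁ (Ls₁ j))) →
      (∀ j, star (ψ₁ (Ls₁ j)) ⬝ᵥ ψ₁ (Ls₁ j) = 1) → ω₁.IsTorusLimitOf ψ₁ Ls₁ →
      ω₁.meanEnergy (hubbardTTPrimeFermionInteraction 0 1 0) 1 ≤ A₁)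
    (hA₁' : ∀ (ω₁ : InfVolFermionState 2) (Ls₁ : ℕ → ℕ), Tendsto Ls₁ atTop atTop →
      ω₁.IsTorusLimitOfMixture (sectorGibbsCount n) (fun L => sectorGibbsWeightTT' β t s₁ U n L)
        (fun L => sectorGibbsVectorTT' t s₁ U n L) Ls₁ →
      ω₁.meanEnergy (hubbardTTPrimeFermionInteraction 0 1 0) 1 ≤ A₁')
    {ω : InfVolFermionState 2} {Ls : ℕ → ℕ}
    (h : ω.IsTorusLimitOfMixture (sectorGibbsCount n) (fun L => sectorGibbsWeightTT' β t s U n L)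
      (fun L => sectorGibbsVectorTT' t s U n L) Ls) (hLs : Tendsto Ls atTop atTop) :
    ω.meanEnergy (hubbardTTPrimeFermionInteraction t s₀ U) 1 ≤
      R₁ + (s₀ - s₁) * max A₁ A₁' + 2 * Real.binEntropy (n / 2) / β := by
  have hpt := h.meanEnergy_anchor_le_of_leftColumn_pointwise_of_sectorGibbs t hs₁ hs₀ hU hn0 hn2 hβ
    hR₁ hA₁ hA₁' hLs
  have h1 := mul_le_mul_of_nonneg_left (le_max_left A₁ A₁') (sub_nonneg.2 hs₁)
  have h2 := mul_le_mul_of_nonneg_left (le_max_right A₁ A₁') (sub_nonneg.2 hs₀)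
  have e : (s₀ - s₁) * max A₁ A₁' = (s - s₁) * max A₁ A₁' + (s₀ - s) * max A₁ A₁' := by ring
  rw [e]
  linarith

/-- **Thermal anchor energy from the RIGHT column, pointwise in `s`.** For `s₀ ≤ s ≤ s₂`, a certified
cap `e(t,s₂,U,n) ≤ R₂`, a ground-state floor word `B₂` at `s₂` and a THERMAL floor word `B₂'` at
`(β, s₂)`: every thermal torus limit `ω` at `(β, s)` has
`e_{Φ(t,s₀,U)}(ω) ≤ R₂ − (s₂ − s)·B₂ − (s − s₀)·B₂' + 2H_b(n/2)/β` (the column's tangent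
`e(t,s,U,n) ≤ R₂ − B₂(s₂ − s)`, and `(s₀ − s)K₂(ω) ≤ (s₀ − s)B₂'` since `s₀ ≤ s`, `B₂' ≤ K₂(ω)`).
[cite: Israel1979, Lemma II.3.1] [cite: KomaTasaki1994, §1] [cite: Lieb1973, §V (5.2)–(5.4)] -/
theorem IsTorusLimitOfMixture.meanEnergy_anchor_le_of_rightColumn_pointwise_of_sectorGibbs (t : ℝ)
    {s₀ s s₂ : ℝ} (hs₀ : s₀ ≤ s) (hs₂ : s ≤ s₂) {U : ℝ} (hU : 0 ≤ U) {n : ℝ} (hn0 : 0 ≤ n)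
    (hn2 : n < 2) {β : ℝ} (hβ : 0 < β) {R₂ B₂ B₂' : ℝ}
    (hR₂ : energyDensityTT' t s₂ U n ≤ R₂)
    (hB₂ : ∀ (ω₂ : InfVolFermionState 2) (Ls₂ : ℕ → ℕ) (ψ₂ : ∀ L, Fock (Orb (FermionTorus 2 L))),
      Tendsto Ls₂ atTop atTop →
      (∀ j, IsGroundStateInSector (hubbardTorusTT' (Ls₂ j) t s₂ U) (rectN n (Ls₂ j)) 0 (ψ₂ (Ls₂ j))) →
      (∀ j, star (ψ₂ (Ls₂ j)) ⬝ᵥ ψ₂ (Ls₂ j) = 1) → ω₂.IsTorusLimitOf ψ₂ Ls₂ →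
      B₂ ≤ ω₂.meanEnergy (hubbardTTPrimeFermionInteraction 0 1 0) 1)
    (hB₂' : ∀ (ω₂ : InfVolFermionState 2) (Ls₂ : ℕ → ℕ), Tendsto Ls₂ atTop atTop →
      ω₂.IsTorusLimitOfMixture (sectorGibbsCount n) (fun L => sectorGibbsWeightTT' β t s₂ U n L)
        (fun L => sectorGibbsVectorTT' t s₂ U n L) Ls₂ →
      B₂' ≤ ω₂.meanEnergy (hubbardTTPrimeFermionInteraction 0 1 0) 1)
    {ω : InfVolFermionState 2} {Ls : ℕ → ℕ}
    (h : ω.IsTorusLimitOfMixture (sectorGibbsCount n) (fun L => sectorGibbsWeightTT' β t s U n L)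
      (fun L => sectorGibbsVectorTT' t s U n L) Ls) (hLs : Tendsto Ls atTop atTop) :
    ω.meanEnergy (hubbardTTPrimeFermionInteraction t s₀ U) 1 ≤
      R₂ - (s₂ - s) * B₂ - (s - s₀) * B₂' + 2 * Real.binEntropy (n / 2) / β := by
  have haff := ω.meanEnergy_hubbardTTPrime_affine t s U s₀ U
  rw [sub_self, zero_mul, add_zero] at haff
  have hcap := h.meanEnergy_hubbardTTPrime_le_energyDensityTT'_add_binEntropy_div t s hU hn0 hn2 hβ hLs
  have hdn := mul_le_energyDensityTT'_sub_of_forall_le_diagHop t hs₂ (le_refl s₂) hU hn0 hn2 hB₂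
  have hK := h.le_meanEnergy_diagHop_of_forall_right_of_sectorGibbs hn0 hn2.le hβ hs₂ hB₂' hLs
  have hprod := mul_le_mul_of_nonpos_left hK (sub_nonpos.2 hs₀)
  rw [haff]
  have e : R₂ - (s₂ - s) * B₂ - (s - s₀) * B₂' = R₂ - B₂ * (s₂ - s) + (s₀ - s) * B₂' := by ring
  rw [e]
  linarith

/-- **Thermal anchor energy from the RIGHT column** (uniform in `s`): for `s₀ ≤ s ≤ s₂`, a cap `R₂`, a
ground-state floor word `B₂` at `s₂` and a thermal floor word `B₂'` at `(β, s₂)` give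
`e_{Φ(t,s₀,U)}(ω) ≤ R₂ − (s₂ − s₀)·min B₂ B₂' + 2H_b(n/2)/β` for every thermal torus limit `ω` at
`(β, s)` (the `T = 0` bound `R₂ − (s₂ − s₀)B₂` of `IsTorusLimitOf.meanEnergy_anchor_le_of_rightColumn`
plus the entropy price when `B₂ = B₂'`).
[cite: Israel1979, Lemma II.3.1] [cite: KomaTasaki1994, §1] [cite: Lieb1973, §V (5.2)–(5.4)] -/
theorem IsTorusLimitOfMixture.meanEnergy_anchor_le_of_rightColumn_of_sectorGibbs (t : ℝ)
    {s₀ s s₂ : ℝ} (hs₀ : s₀ ≤ s) (hs₂ : s ≤ s₂) {U : ℝ} (hU : 0 ≤ U) {n : ℝ} (hn0 : 0 ≤ n)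
    (hn2 : n < 2) {β : ℝ} (hβ : 0 < β) {R₂ B₂ B₂' : ℝ}
    (hR₂ : energyDensityTT' t s₂ U n ≤ R₂)
    (hB₂ : ∀ (ω₂ : InfVolFermionState 2) (Ls₂ : ℕ → ℕ) (ψ₂ : ∀ L, Fock (Orb (FermionTorus 2 L))),
      Tendsto Ls₂ atTop atTop →
      (∀ j, IsGroundStateInSector (hubbardTorusTT' (Ls₂ j) t s₂ U) (rectN n (Ls₂ j)) 0 (ψ₂ (Ls₂ j))) →
      (∀ j, star (ψ₂ (Ls₂ j)) ⬝ᵥ ψ₂ (Ls₂ j) = 1) → ω₂.IsTorusLimitOf ψ₂ Ls₂ →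
      B₂ ≤ ω₂.meanEnergy (hubbardTTPrimeFermionInteraction 0 1 0) 1)
    (hB₂' : ∀ (ω₂ : InfVolFermionState 2) (Ls₂ : ℕ → ℕ), Tendsto Ls₂ atTop atTop →
      ω₂.IsTorusLimitOfMixture (sectorGibbsCount n) (fun L => sectorGibbsWeightTT' β t s₂ U n L)
        (fun L => sectorGibbsVectorTT' t s₂ U n L) Ls₂ →
      B₂' ≤ ω₂.meanEnergy (hubbardTTPrimeFermionInteraction 0 1 0) 1)
    {ω : InfVolFermionState 2} {Ls : ℕ → ℕ}
    (h : ω.IsTorusLimitOfMixture (sectorGibbsCount n) (fun L => sectorGibbsWeightTT' β t s U n L)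
      (fun L => sectorGibbsVectorTT' t s U n L) Ls) (hLs : Tendsto Ls atTop atTop) :
    ω.meanEnergy (hubbardTTPrimeFermionInteraction t s₀ U) 1 ≤
      R₂ - (s₂ - s₀) * min B₂ B₂' + 2 * Real.binEntropy (n / 2) / β := by
  have hpt := h.meanEnergy_anchor_le_of_rightColumn_pointwise_of_sectorGibbs t hs₀ hs₂ hU hn0 hn2 hβ
    hR₂ hB₂ hB₂' hLs
  have h1 := mul_le_mul_of_nonneg_left (min_le_left B₂ B₂') (sub_nonneg.2 hs₂)
  have h2 := mul_le_mul_of_nonneg_left (min_le_right B₂ B₂') (sub_nonneg.2 hs₀)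
  have e : (s₂ - s₀) * min B₂ B₂' = (s₂ - s) * min B₂ B₂' + (s - s₀) * min B₂ B₂' := by ring
  rw [e]
  linarith

/-- **Thermal anchor energy between two capped and worded columns.** For a point `s ∈ [s₁, s₂]` and
any anchor `s₀` (in practice in the cell; no hypothesis on its position is needed): caps `R₁`, `R₂`,
ground-state words `A₁` (ceiling at `s₁`), `B₂` (floor at `s₂`) and thermal words `A₁'` at `(β, s₁)`,
`B₂'` at `(β, s₂)` give, for every thermal torus limit `ω` at `(β, s)`,
`e_{Φ(t,s₀,U)}(ω) ≤ max (R₁ + (s₀ − s₁)·max A₁ A₁') (R₂ − (s₂ − s₀)·min B₂ B₂') + 2H_b(n/2)/β`.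
[cite: Israel1979, Lemma II.3.1] [cite: KomaTasaki1994, §1] [cite: WangEtAl2024, §III] -/
theorem IsTorusLimitOfMixture.meanEnergy_anchor_le_of_outerColumns_of_sectorGibbs (t : ℝ)
    {s₁ s₂ s₀ s : ℝ} (hs : s ∈ Set.Icc s₁ s₂) {U : ℝ} (hU : 0 ≤ U) {n : ℝ} (hn0 : 0 ≤ n)
    (hn2 : n < 2) {β : ℝ} (hβ : 0 < β) {R₁ A₁ A₁' R₂ B₂ B₂' : ℝ}
    (hR₁ : energyDensityTT' t s₁ U n ≤ R₁) (hR₂ : energyDensityTT' t s₂ U n ≤ R₂)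
    (hA₁ : ∀ (ω₁ : InfVolFermionState 2) (Ls₁ : ℕ → ℕ) (ψ₁ : ∀ L, Fock (Orb (FermionTorus 2 L))),
      Tendsto Ls₁ atTop atTop →
      (∀ j, IsGroundStateInSector (hubbardTorusTT' (Ls₁ j) t s₁ U) (rectN n (Ls₁ j)) 0 (ψ₁ (Ls₁ j))) →
      (∀ j, star (ψ₁ (Ls₁ j)) ⬝ᵥ ψ₁ (Ls₁ j) = 1) → ω₁.IsTorusLimitOf ψ₁ Ls₁ →
      ω₁.meanEnergy (hubbardTTPrimeFermionInteraction 0 1 0) 1 ≤ A₁)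
    (hA₁' : ∀ (ω₁ : InfVolFermionState 2) (Ls₁ : ℕ → ℕ), Tendsto Ls₁ atTop atTop →
      ω₁.IsTorusLimitOfMixture (sectorGibbsCount n) (fun L => sectorGibbsWeightTT' β t s₁ U n L)
        (fun L => sectorGibbsVectorTT' t s₁ U n L) Ls₁ →
      ω₁.meanEnergy (hubbardTTPrimeFermionInteraction 0 1 0) 1 ≤ A₁')
    (hB₂ : ∀ (ω₂ : InfVolFermionState 2) (Ls₂ : ℕ → ℕ) (ψ₂ : ∀ L, Fock (Orb (FermionTorus 2 L))),
      Tendsto Ls₂ atTop atTop →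
      (∀ j, IsGroundStateInSector (hubbardTorusTT' (Ls₂ j) t s₂ U) (rectN n (Ls₂ j)) 0 (ψ₂ (Ls₂ j))) →
      (∀ j, star (ψ₂ (Ls₂ j)) ⬝ᵥ ψ₂ (Ls₂ j) = 1) → ω₂.IsTorusLimitOf ψ₂ Ls₂ →
      B₂ ≤ ω₂.meanEnergy (hubbardTTPrimeFermionInteraction 0 1 0) 1)
    (hB₂' : ∀ (ω₂ : InfVolFermionState 2) (Ls₂ : ℕ → ℕ), Tendsto Ls₂ atTop atTop →
      ω₂.IsTorusLimitOfMixture (sectorGibbsCount n) (fun L => sectorGibbsWeightTT' β t s₂ U n L)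
        (fun L => sectorGibbsVectorTT' t s₂ U n L) Ls₂ →
      B₂' ≤ ω₂.meanEnergy (hubbardTTPrimeFermionInteraction 0 1 0) 1)
    {ω : InfVolFermionState 2} {Ls : ℕ → ℕ}
    (h : ω.IsTorusLimitOfMixture (sectorGibbsCount n) (fun L => sectorGibbsWeightTT' β t s U n L)
      (fun L => sectorGibbsVectorTT' t s U n L) Ls) (hLs : Tendsto Ls atTop atTop) :
    ω.meanEnergy (hubbardTTPrimeFermionInteraction t s₀ U) 1 ≤
      max (R₁ + (s₀ - s₁) * max A₁ A₁') (R₂ - (s₂ - s₀) * min B₂ B₂') +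
        2 * Real.binEntropy (n / 2) / β := by
  rcases le_total s s₀ with hle | hge
  · have hl := h.meanEnergy_anchor_le_of_leftColumn_of_sectorGibbs t hs.1 hle hU hn0 hn2 hβ hR₁ hA₁
      hA₁' hLs
    linarith [le_max_left (R₁ + (s₀ - s₁) * max A₁ A₁') (R₂ - (s₂ - s₀) * min B₂ B₂')]
  · have hr := h.meanEnergy_anchor_le_of_rightColumn_of_sectorGibbs t hge hs.2 hU hn0 hn2 hβ hR₂ hB₂
      hB₂' hLs
    linarith [le_max_right (R₁ + (s₀ - s₁) * max A₁ A₁') (R₂ - (s₂ - s₀) * min B₂ B₂')]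

/-- **The thermal anchor WINDOW from the outer columns**: same data,
`e(t,s₀,U,n) ≤ e_{Φ(t,s₀,U)}(ω) ≤ max (R₁ + (s₀ − s₁)·max A₁ A₁') (R₂ − (s₂ − s₀)·min B₂ B₂') + 2H_b(n/2)/β`
— the lower end is the cut row of the convention (variational principle at the anchor coupling).
[cite: Israel1979, Lemma II.3.1] [cite: KomaTasaki1994, §1] -/
theorem IsTorusLimitOfMixture.meanEnergy_anchor_mem_Icc_of_outerColumns_of_sectorGibbs (t : ℝ)
    {s₁ s₂ s₀ s : ℝ} (hs : s ∈ Set.Icc s₁ s₂) {U : ℝ} (hU : 0 ≤ U) {n : ℝ} (hn0 : 0 ≤ n)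
    (hn2 : n < 2) {β : ℝ} (hβ : 0 < β) {R₁ A₁ A₁' R₂ B₂ B₂' : ℝ}
    (hR₁ : energyDensityTT' t s₁ U n ≤ R₁) (hR₂ : energyDensityTT' t s₂ U n ≤ R₂)
    (hA₁ : ∀ (ω₁ : InfVolFermionState 2) (Ls₁ : ℕ → ℕ) (ψ₁ : ∀ L, Fock (Orb (FermionTorus 2 L))),
      Tendsto Ls₁ atTop atTop →
      (∀ j, IsGroundStateInSector (hubbardTorusTT' (Ls₁ j) t s₁ U) (rectN n (Ls₁ j)) 0 (ψ₁ (Ls₁ j))) →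
      (∀ j, star (ψ₁ (Ls₁ j)) ⬝ᵥ ψ₁ (Ls₁ j) = 1) → ω₁.IsTorusLimitOf ψ₁ Ls₁ →
      ω₁.meanEnergy (hubbardTTPrimeFermionInteraction 0 1 0) 1 ≤ A₁)
    (hA₁' : ∀ (ω₁ : InfVolFermionState 2) (Ls₁ : ℕ → ℕ), Tendsto Ls₁ atTop atTop →
      ω₁.IsTorusLimitOfMixture (sectorGibbsCount n) (fun L => sectorGibbsWeightTT' β t s₁ U n L)
        (fun L => sectorGibbsVectorTT' t s₁ U n L) Ls₁ →
      ω₁.meanEnergy (hubbardTTPrimeFermionInteraction 0 1 0) 1 ≤ A₁')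
    (hB₂ : ∀ (ω₂ : InfVolFermionState 2) (Ls₂ : ℕ → ℕ) (ψ₂ : ∀ L, Fock (Orb (FermionTorus 2 L))),
      Tendsto Ls₂ atTop atTop →
      (∀ j, IsGroundStateInSector (hubbardTorusTT' (Ls₂ j) t s₂ U) (rectN n (Ls₂ j)) 0 (ψ₂ (Ls₂ j))) →
      (∀ j, star (ψ₂ (Ls₂ j)) ⬝ᵥ ψ₂ (Ls₂ j) = 1) → ω₂.IsTorusLimitOf ψ₂ Ls₂ →
      B₂ ≤ ω₂.meanEnergy (hubbardTTPrimeFermionInteraction 0 1 0) 1)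
    (hB₂' : ∀ (ω₂ : InfVolFermionState 2) (Ls₂ : ℕ → ℕ), Tendsto Ls₂ atTop atTop →
      ω₂.IsTorusLimitOfMixture (sectorGibbsCount n) (fun L => sectorGibbsWeightTT' β t s₂ U n L)
        (fun L => sectorGibbsVectorTT' t s₂ U n L) Ls₂ →
      B₂' ≤ ω₂.meanEnergy (hubbardTTPrimeFermionInteraction 0 1 0) 1)
    {ω : InfVolFermionState 2} {Ls : ℕ → ℕ}
    (h : ω.IsTorusLimitOfMixture (sectorGibbsCount n) (fun L => sectorGibbsWeightTT' β t s U n L)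
      (fun L => sectorGibbsVectorTT' t s U n L) Ls) (hLs : Tendsto Ls atTop atTop) :
    ω.meanEnergy (hubbardTTPrimeFermionInteraction t s₀ U) 1 ∈
      Set.Icc (energyDensityTT' t s₀ U n)
        (max (R₁ + (s₀ - s₁) * max A₁ A₁') (R₂ - (s₂ - s₀) * min B₂ B₂') +
          2 * Real.binEntropy (n / 2) / β) :=
  ⟨h.energyDensityTT'_le_meanEnergy_of_sectorGibbs t s U hn0 hn2 β hLs s₀ hU,
    h.meanEnergy_anchor_le_of_outerColumns_of_sectorGibbs t hs hU hn0 hn2 hβ hR₁ hR₂ hA₁ hA₁' hB₂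
      hB₂' hLs⟩

/-! ### §2 Word-free: the far column's cap, the kinematic row `|K₂| ≤ 16/π²` and the entropy price -/

/-- **Thermal anchor energy from a LEFT cap alone (kinematic).** For `s₁ ≤ s ≤ s₀`, a certified cap
`e(t,s₁,U,n) ≤ R₁` gives `e_{Φ(t,s₀,U)}(ω) ≤ R₁ + (16/π²)(s₀ − s₁) + 2H_b(n/2)/β` for every thermal
torus limit `ω` at `(β, s)` (kinematic cap transport `e(t,s,U,n) ≤ R₁ + (16/π²)(s − s₁)`, the thermal
kinematic row `K₂(ω) ≤ 16/π²` and the energy–entropy cap) — the gap at `16/π²`, against `32/π²` for the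
one-anchor form `IsTorusLimitOfMixture.meanEnergy_anchor_mem_Icc_kinematic_of_sectorGibbs`, and no cap at
the anchor. [cite: Israel1979, Lemma II.3.1] [cite: LiebLoss1993, §8, Theorem 8.2] -/
theorem IsTorusLimitOfMixture.meanEnergy_anchor_le_of_leftCap_kinematic_of_sectorGibbs (t : ℝ)
    {s₁ s s₀ : ℝ} (hs₁ : s₁ ≤ s) (hs₀ : s ≤ s₀) {U : ℝ} (hU : 0 ≤ U) {n : ℝ} (hn0 : 0 ≤ n)
    (hn2 : n < 2) {β : ℝ} (hβ : 0 < β) {R₁ : ℝ} (hR₁ : energyDensityTT' t s₁ U n ≤ R₁)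
    {ω : InfVolFermionState 2} {Ls : ℕ → ℕ}
    (h : ω.IsTorusLimitOfMixture (sectorGibbsCount n) (fun L => sectorGibbsWeightTT' β t s U n L)
      (fun L => sectorGibbsVectorTT' t s U n L) Ls) (hLs : Tendsto Ls atTop atTop) :
    ω.meanEnergy (hubbardTTPrimeFermionInteraction t s₀ U) 1 ≤
      R₁ + 16 / Real.pi ^ 2 * (s₀ - s₁) + 2 * Real.binEntropy (n / 2) / β := by
  have haff := ω.meanEnergy_hubbardTTPrime_affine t s U s₀ U
  rw [sub_self, zero_mul, add_zero] at haff
  have hcap := h.meanEnergy_hubbardTTPrime_le_energyDensityTT'_add_binEntropy_div t s hU hn0 hn2 hβ hLs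
  have hkin := energyDensityTT'_le_of_upperBound_tPrime_kinematic t hU hn0 hn2 (s' := s) hR₁
  rw [abs_of_nonneg (sub_nonneg.2 hs₁)] at hkin
  have hK := (abs_le.1 (h.abs_meanEnergy_diagHop_le_of_sectorGibbs t s U hn0 hn2 β hLs)).2
  have hprod := mul_le_mul_of_nonneg_left hK (sub_nonneg.2 hs₀)
  rw [haff]
  have e : R₁ + 16 / Real.pi ^ 2 * (s₀ - s₁) =
      R₁ + 16 / Real.pi ^ 2 * (s - s₁) + (s₀ - s) * (16 / Real.pi ^ 2) := by ring
  rw [e]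
  linarith

/-- **Thermal anchor energy from a RIGHT cap alone (kinematic).** For `s₀ ≤ s ≤ s₂`, a certified cap
`e(t,s₂,U,n) ≤ R₂` gives `e_{Φ(t,s₀,U)}(ω) ≤ R₂ + (16/π²)(s₂ − s₀) + 2H_b(n/2)/β` for every thermal
torus limit `ω` at `(β, s)`. [cite: Israel1979, Lemma II.3.1] [cite: LiebLoss1993, §8, Theorem 8.2] -/
theorem IsTorusLimitOfMixture.meanEnergy_anchor_le_of_rightCap_kinematic_of_sectorGibbs (t : ℝ)
    {s₀ s s₂ : ℝ} (hs₀ : s₀ ≤ s) (hs₂ : s ≤ s₂) {U : ℝ} (hU : 0 ≤ U) {n : ℝ} (hn0 : 0 ≤ n)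
    (hn2 : n < 2) {β : ℝ} (hβ : 0 < β) {R₂ : ℝ} (hR₂ : energyDensityTT' t s₂ U n ≤ R₂)
    {ω : InfVolFermionState 2} {Ls : ℕ → ℕ}
    (h : ω.IsTorusLimitOfMixture (sectorGibbsCount n) (fun L => sectorGibbsWeightTT' β t s U n L)
      (fun L => sectorGibbsVectorTT' t s U n L) Ls) (hLs : Tendsto Ls atTop atTop) :
    ω.meanEnergy (hubbardTTPrimeFermionInteraction t s₀ U) 1 ≤
      R₂ + 16 / Real.pi ^ 2 * (s₂ - s₀) + 2 * Real.binEntropy (n / 2) / β := by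
  have haff := ω.meanEnergy_hubbardTTPrime_affine t s U s₀ U
  rw [sub_self, zero_mul, add_zero] at haff
  have hcap := h.meanEnergy_hubbardTTPrime_le_energyDensityTT'_add_binEntropy_div t s hU hn0 hn2 hβ hLs
  have hkin := energyDensityTT'_le_of_upperBound_tPrime_kinematic t hU hn0 hn2 (s' := s) hR₂
  rw [abs_of_nonpos (sub_nonpos.2 hs₂)] at hkin
  have hK := (abs_le.1 (h.abs_meanEnergy_diagHop_le_of_sectorGibbs t s U hn0 hn2 β hLs)).1
  have hprod := mul_le_mul_of_nonpos_left hK (sub_nonpos.2 hs₀)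
  rw [haff]
  have e : R₂ + 16 / Real.pi ^ 2 * (s₂ - s₀) =
      R₂ + 16 / Real.pi ^ 2 * (-(s - s₂)) + (s₀ - s) * (-(16 / Real.pi ^ 2)) := by ring
  rw [e]
  linarith

/-- **Thermal anchor energy from the two OUTER caps (kinematic)**, any anchor `s₀`, `s ∈ [s₁, s₂]`:
`e_{Φ(t,s₀,U)}(ω) ≤ max (R₁ + (16/π²)(s₀ − s₁)) (R₂ + (16/π²)(s₂ − s₀)) + 2H_b(n/2)/β` for every thermal
torus limit `ω` at `(β, s)`. [cite: Israel1979, Lemma II.3.1] [cite: LiebLoss1993, §8, Theorem 8.2] -/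
theorem IsTorusLimitOfMixture.meanEnergy_anchor_le_of_outerCaps_kinematic_of_sectorGibbs (t : ℝ)
    {s₁ s₂ s₀ s : ℝ} (hs : s ∈ Set.Icc s₁ s₂) {U : ℝ} (hU : 0 ≤ U) {n : ℝ} (hn0 : 0 ≤ n)
    (hn2 : n < 2) {β : ℝ} (hβ : 0 < β) {R₁ R₂ : ℝ}
    (hR₁ : energyDensityTT' t s₁ U n ≤ R₁) (hR₂ : energyDensityTT' t s₂ U n ≤ R₂)
    {ω : InfVolFermionState 2} {Ls : ℕ → ℕ}
    (h : ω.IsTorusLimitOfMixture (sectorGibbsCount n) (fun L => sectorGibbsWeightTT' β t s U n L)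
      (fun L => sectorGibbsVectorTT' t s U n L) Ls) (hLs : Tendsto Ls atTop atTop) :
    ω.meanEnergy (hubbardTTPrimeFermionInteraction t s₀ U) 1 ≤
      max (R₁ + 16 / Real.pi ^ 2 * (s₀ - s₁)) (R₂ + 16 / Real.pi ^ 2 * (s₂ - s₀)) +
        2 * Real.binEntropy (n / 2) / β := by
  rcases le_total s s₀ with hle | hge
  · have hl := h.meanEnergy_anchor_le_of_leftCap_kinematic_of_sectorGibbs t hs.1 hle hU hn0 hn2 hβ
      hR₁ hLs
    linarith [le_max_left (R₁ + 16 / Real.pi ^ 2 * (s₀ - s₁)) (R₂ + 16 / Real.pi ^ 2 * (s₂ - s₀))]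
  · have hr := h.meanEnergy_anchor_le_of_rightCap_kinematic_of_sectorGibbs t hge hs.2 hU hn0 hn2 hβ
      hR₂ hLs
    linarith [le_max_right (R₁ + 16 / Real.pi ^ 2 * (s₀ - s₁)) (R₂ + 16 / Real.pi ^ 2 * (s₂ - s₀))]

/-! ### §3 BOX ⇒ WORD in the thermal cap class: a certificate at the anchor, booked with the far
column's tangent plus the entropy price, words the cell (fixed `β` with words; `T ≤ 1/β` kinematically) -/

/-- **BOX ⇒ WORD at `T > 0`, cell left of the anchor (fixed `β`).** Fix `t`, `U ≥ 0`, `0 ≤ n < 2`,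
`β > 0`, a column `s₁ ≤ s₀` with a cap `e(t,s₁,U,n) ≤ R₁`, a ground-state ceiling word `A₁` and a thermal
ceiling word `A₁'` at `(β, s₁)`, and a property `P` of infinite-volume states certified AT THE ANCHOR
`(t, s₀, U)` for the thermal CAP CLASS: every torus limit along `Ls → ∞` of finite mixtures (nonnegative
weights summing to one, unit `rectN n L`-particle components) whose anchor energy satisfies
`e_{Φ(t,s₀,U)}(ω) ≤ u` (the hypothesis class of an eom-free certificate; the shape of
`forall_sectorGibbsLimit_tPrime_box_of_forall_cap`). If `R₁ + (s₀ − s₁)·max A₁ A₁' + 2H_b(n/2)/β ≤ u`,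
then `P ω` for every thermal torus limit `ω` at `(β, s)`, every `s ∈ [s₁, s₀]`. The `T > 0` twin of
`forall_groundState_tPrime_cell_of_forall_cap_leftColumn`.
[cite: WangEtAl2024, §III] [cite: Israel1979, Lemma II.3.1] [cite: Lieb1973, §V (5.2)–(5.4)] -/
theorem forall_sectorGibbsLimit_tPrime_cell_of_forall_cap_leftColumn (t : ℝ) {s₁ s₀ : ℝ}
    {U : ℝ} (hU : 0 ≤ U) {n : ℝ} (hn0 : 0 ≤ n) (hn2 : n < 2) {β : ℝ} (hβ : 0 < β)
    {R₁ A₁ A₁' u : ℝ} (hR₁ : energyDensityTT' t s₁ U n ≤ R₁)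
    (hA₁ : ∀ (ω₁ : InfVolFermionState 2) (Ls₁ : ℕ → ℕ) (ψ₁ : ∀ L, Fock (Orb (FermionTorus 2 L))),
      Tendsto Ls₁ atTop atTop →
      (∀ j, IsGroundStateInSector (hubbardTorusTT' (Ls₁ j) t s₁ U) (rectN n (Ls₁ j)) 0 (ψ₁ (Ls₁ j))) →
      (∀ j, star (ψ₁ (Ls₁ j)) ⬝ᵥ ψ₁ (Ls₁ j) = 1) → ω₁.IsTorusLimitOf ψ₁ Ls₁ →
      ω₁.meanEnergy (hubbardTTPrimeFermionInteraction 0 1 0) 1 ≤ A₁)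
    (hA₁' : ∀ (ω₁ : InfVolFermionState 2) (Ls₁ : ℕ → ℕ), Tendsto Ls₁ atTop atTop →
      ω₁.IsTorusLimitOfMixture (sectorGibbsCount n) (fun L => sectorGibbsWeightTT' β t s₁ U n L)
        (fun L => sectorGibbsVectorTT' t s₁ U n L) Ls₁ →
      ω₁.meanEnergy (hubbardTTPrimeFermionInteraction 0 1 0) 1 ≤ A₁')
    (hu : R₁ + (s₀ - s₁) * max A₁ A₁' + 2 * Real.binEntropy (n / 2) / β ≤ u)
    {P : InfVolFermionState 2 → Prop}
    (hP : ∀ (ω : InfVolFermionState 2) (m : ℕ → ℕ) (p : ∀ L, Fin (m L) → ℝ)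
      (ψ : ∀ L, Fin (m L) → Fock (Orb (FermionTorus 2 L))) (Ls : ℕ → ℕ),
      Tendsto Ls atTop atTop → (∀ L i, 0 ≤ p L i) → (∀ L, ∑ i, p L i = 1) →
      (∀ L i, IsNParticle (rectN n L) (ψ L i)) → (∀ L i, star (ψ L i) ⬝ᵥ ψ L i = 1) →
      ω.IsTorusLimitOfMixture m p ψ Ls →
      ω.meanEnergy (hubbardTTPrimeFermionInteraction t s₀ U) 1 ≤ u → P ω)
    {s : ℝ} (hs : s ∈ Set.Icc s₁ s₀)
    {ω : InfVolFermionState 2} {Ls : ℕ → ℕ}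
    (h : ω.IsTorusLimitOfMixture (sectorGibbsCount n) (fun L => sectorGibbsWeightTT' β t s U n L)
      (fun L => sectorGibbsVectorTT' t s U n L) Ls) (hLs : Tendsto Ls atTop atTop) : P ω :=
  hP ω (sectorGibbsCount n) _ _ Ls hLs
    (fun L i => sectorGibbsWeightTT'_nonneg β t s U n L i)
    (fun L => sum_sectorGibbsWeightTT' β t s U hn0 hn2.le L)
    (fun L i => isNParticle_sectorGibbsVectorTT' t s U n L i)
    (fun L i => star_sectorGibbsVectorTT'_dotProduct_self t s U n L i) h
    ((h.meanEnergy_anchor_le_of_leftColumn_of_sectorGibbs t hs.1 hs.2 hU hn0 hn2 hβ hR₁ hA₁ hA₁'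
      hLs).trans hu)

/-- **BOX ⇒ WORD at `T > 0`, cell right of the anchor (fixed `β`).** A column `s₂ ≥ s₀` with a cap `R₂`,
a ground-state floor word `B₂` and a thermal floor word `B₂'` at `(β, s₂)`; if
`R₂ − (s₂ − s₀)·min B₂ B₂' + 2H_b(n/2)/β ≤ u`, the anchor's thermal cap-class property `P` holds for every
thermal torus limit at `(β, s)`, every `s ∈ [s₀, s₂]`. The `T > 0` twin of
`forall_groundState_tPrime_cell_of_forall_cap_rightColumn`.
[cite: WangEtAl2024, §III] [cite: Israel1979, Lemma II.3.1] [cite: Lieb1973, §V (5.2)–(5.4)] -/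
theorem forall_sectorGibbsLimit_tPrime_cell_of_forall_cap_rightColumn (t : ℝ) {s₀ s₂ : ℝ}
    {U : ℝ} (hU : 0 ≤ U) {n : ℝ} (hn0 : 0 ≤ n) (hn2 : n < 2) {β : ℝ} (hβ : 0 < β)
    {R₂ B₂ B₂' u : ℝ} (hR₂ : energyDensityTT' t s₂ U n ≤ R₂)
    (hB₂ : ∀ (ω₂ : InfVolFermionState 2) (Ls₂ : ℕ → ℕ) (ψ₂ : ∀ L, Fock (Orb (FermionTorus 2 L))),
      Tendsto Ls₂ atTop atTop →
      (∀ j, IsGroundStateInSector (hubbardTorusTT' (Ls₂ j) t s₂ U) (rectN n (Ls₂ j)) 0 (ψ₂ (Ls₂ j))) →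
      (∀ j, star (ψ₂ (Ls₂ j)) ⬝ᵥ ψ₂ (Ls₂ j) = 1) → ω₂.IsTorusLimitOf ψ₂ Ls₂ →
      B₂ ≤ ω₂.meanEnergy (hubbardTTPrimeFermionInteraction 0 1 0) 1)
    (hB₂' : ∀ (ω₂ : InfVolFermionState 2) (Ls₂ : ℕ → ℕ), Tendsto Ls₂ atTop atTop →
      ω₂.IsTorusLimitOfMixture (sectorGibbsCount n) (fun L => sectorGibbsWeightTT' β t s₂ U n L)
        (fun L => sectorGibbsVectorTT' t s₂ U n L) Ls₂ →
      B₂' ≤ ω₂.meanEnergy (hubbardTTPrimeFermionInteraction 0 1 0) 1)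
    (hu : R₂ - (s₂ - s₀) * min B₂ B₂' + 2 * Real.binEntropy (n / 2) / β ≤ u)
    {P : InfVolFermionState 2 → Prop}
    (hP : ∀ (ω : InfVolFermionState 2) (m : ℕ → ℕ) (p : ∀ L, Fin (m L) → ℝ)
      (ψ : ∀ L, Fin (m L) → Fock (Orb (FermionTorus 2 L))) (Ls : ℕ → ℕ),
      Tendsto Ls atTop atTop → (∀ L i, 0 ≤ p L i) → (∀ L, ∑ i, p L i = 1) →
      (∀ L i, IsNParticle (rectN n L) (ψ L i)) → (∀ L i, star (ψ L i) ⬝ᵥ ψ L i = 1) →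
      ω.IsTorusLimitOfMixture m p ψ Ls →
      ω.meanEnergy (hubbardTTPrimeFermionInteraction t s₀ U) 1 ≤ u → P ω)
    {s : ℝ} (hs : s ∈ Set.Icc s₀ s₂)
    {ω : InfVolFermionState 2} {Ls : ℕ → ℕ}
    (h : ω.IsTorusLimitOfMixture (sectorGibbsCount n) (fun L => sectorGibbsWeightTT' β t s U n L)
      (fun L => sectorGibbsVectorTT' t s U n L) Ls) (hLs : Tendsto Ls atTop atTop) : P ω :=
  hP ω (sectorGibbsCount n) _ _ Ls hLs
    (fun L i => sectorGibbsWeightTT'_nonneg β t s U n L i)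
    (fun L => sum_sectorGibbsWeightTT' β t s U hn0 hn2.le L)
    (fun L i => isNParticle_sectorGibbsVectorTT' t s U n L i)
    (fun L i => star_sectorGibbsVectorTT'_dotProduct_self t s U n L i) h
    ((h.meanEnergy_anchor_le_of_rightColumn_of_sectorGibbs t hs.1 hs.2 hU hn0 hn2 hβ hR₂ hB₂ hB₂'
      hLs).trans hu)

/-- **BOX ⇒ WORD at `T > 0`, anchor with both outer columns (fixed `β`).** Any anchor `s₀` (in practice
in `[s₁, s₂]`), caps `R₁`, `R₂`, ground-state words `A₁` / `B₂` and thermal words `A₁'` / `B₂'` at the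
columns; if `max (R₁ + (s₀ − s₁)·max A₁ A₁') (R₂ − (s₂ − s₀)·min B₂ B₂') + 2H_b(n/2)/β ≤ u`, the anchor's
thermal cap-class property `P` holds for every thermal torus limit at `(β, s)`, every `s ∈ [s₁, s₂]`
(against the one-anchor booking `u₀ + 2H_b(n/2)/β + max(0, (s₂ − s₀)(A₀ − B₂'), (s₀ − s₁)(A₁' − B₀))` of
`forall_sectorGibbsLimit_tPrime_box_of_forall_cap`). The `T > 0` twin of
`forall_groundState_tPrime_cell_of_forall_cap_outerColumns`.
[cite: WangEtAl2024, §III] [cite: Israel1979, Lemma II.3.1] [cite: Lieb1973, §V (5.2)–(5.4)] -/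
theorem forall_sectorGibbsLimit_tPrime_cell_of_forall_cap_outerColumns (t : ℝ) {s₁ s₂ s₀ : ℝ}
    {U : ℝ} (hU : 0 ≤ U) {n : ℝ} (hn0 : 0 ≤ n) (hn2 : n < 2) {β : ℝ} (hβ : 0 < β)
    {R₁ A₁ A₁' R₂ B₂ B₂' u : ℝ}
    (hR₁ : energyDensityTT' t s₁ U n ≤ R₁) (hR₂ : energyDensityTT' t s₂ U n ≤ R₂)
    (hA₁ : ∀ (ω₁ : InfVolFermionState 2) (Ls₁ : ℕ → ℕ) (ψ₁ : ∀ L, Fock (Orb (FermionTorus 2 L))),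
      Tendsto Ls₁ atTop atTop →
      (∀ j, IsGroundStateInSector (hubbardTorusTT' (Ls₁ j) t s₁ U) (rectN n (Ls₁ j)) 0 (ψ₁ (Ls₁ j))) →
      (∀ j, star (ψ₁ (Ls₁ j)) ⬝ᵥ ψ₁ (Ls₁ j) = 1) → ω₁.IsTorusLimitOf ψ₁ Ls₁ →
      ω₁.meanEnergy (hubbardTTPrimeFermionInteraction 0 1 0) 1 ≤ A₁)
    (hA₁' : ∀ (ω₁ : InfVolFermionState 2) (Ls₁ : ℕ → ℕ), Tendsto Ls₁ atTop atTop →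
      ω₁.IsTorusLimitOfMixture (sectorGibbsCount n) (fun L => sectorGibbsWeightTT' β t s₁ U n L)
        (fun L => sectorGibbsVectorTT' t s₁ U n L) Ls₁ →
      ω₁.meanEnergy (hubbardTTPrimeFermionInteraction 0 1 0) 1 ≤ A₁')
    (hB₂ : ∀ (ω₂ : InfVolFermionState 2) (Ls₂ : ℕ → ℕ) (ψ₂ : ∀ L, Fock (Orb (FermionTorus 2 L))),
      Tendsto Ls₂ atTop atTop →
      (∀ j, IsGroundStateInSector (hubbardTorusTT' (Ls₂ j) t s₂ U) (rectN n (Ls₂ j)) 0 (ψ₂ (Ls₂ j))) →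
      (∀ j, star (ψ₂ (Ls₂ j)) ⬝ᵥ ψ₂ (Ls₂ j) = 1) → ω₂.IsTorusLimitOf ψ₂ Ls₂ →
      B₂ ≤ ω₂.meanEnergy (hubbardTTPrimeFermionInteraction 0 1 0) 1)
    (hB₂' : ∀ (ω₂ : InfVolFermionState 2) (Ls₂ : ℕ → ℕ), Tendsto Ls₂ atTop atTop →
      ω₂.IsTorusLimitOfMixture (sectorGibbsCount n) (fun L => sectorGibbsWeightTT' β t s₂ U n L)
        (fun L => sectorGibbsVectorTT' t s₂ U n L) Ls₂ →
      B₂' ≤ ω₂.meanEnergy (hubbardTTPrimeFermionInteraction 0 1 0) 1)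
    (hu : max (R₁ + (s₀ - s₁) * max A₁ A₁') (R₂ - (s₂ - s₀) * min B₂ B₂') +
      2 * Real.binEntropy (n / 2) / β ≤ u)
    {P : InfVolFermionState 2 → Prop}
    (hP : ∀ (ω : InfVolFermionState 2) (m : ℕ → ℕ) (p : ∀ L, Fin (m L) → ℝ)
      (ψ : ∀ L, Fin (m L) → Fock (Orb (FermionTorus 2 L))) (Ls : ℕ → ℕ),
      Tendsto Ls atTop atTop → (∀ L i, 0 ≤ p L i) → (∀ L, ∑ i, p L i = 1) →
      (∀ L i, IsNParticle (rectN n L) (ψ L i)) → (∀ L i, star (ψ L i) ⬝ᵥ ψ L i = 1) →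
      ω.IsTorusLimitOfMixture m p ψ Ls →
      ω.meanEnergy (hubbardTTPrimeFermionInteraction t s₀ U) 1 ≤ u → P ω)
    {s : ℝ} (hs : s ∈ Set.Icc s₁ s₂)
    {ω : InfVolFermionState 2} {Ls : ℕ → ℕ}
    (h : ω.IsTorusLimitOfMixture (sectorGibbsCount n) (fun L => sectorGibbsWeightTT' β t s U n L)
      (fun L => sectorGibbsVectorTT' t s U n L) Ls) (hLs : Tendsto Ls atTop atTop) : P ω :=
  hP ω (sectorGibbsCount n) _ _ Ls hLs
    (fun L i => sectorGibbsWeightTT'_nonneg β t s U n L i)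
    (fun L => sum_sectorGibbsWeightTT' β t s U hn0 hn2.le L)
    (fun L i => isNParticle_sectorGibbsVectorTT' t s U n L i)
    (fun L i => star_sectorGibbsVectorTT'_dotProduct_self t s U n L i) h
    ((h.meanEnergy_anchor_le_of_outerColumns_of_sectorGibbs t hs hU hn0 hn2 hβ hR₁ hR₂ hA₁ hA₁' hB₂
      hB₂' hLs).trans hu)

/-- **BOX ⇒ WORD on the `(cell) × (T ≤ 1/β)`, word-free (two outer caps, kinematic row).** Caps `R₁` at
`s₁` and `R₂` at `s₂`, any anchor `s₀`; if `max (R₁ + (16/π²)(s₀ − s₁)) (R₂ + (16/π²)(s₂ − s₀)) +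
2H_b(n/2)/β ≤ u`, the anchor's thermal cap-class property `P` holds for every thermal torus limit at
`(β', s)`, every `s ∈ [s₁, s₂]` and EVERY `β' ≥ β` (the entropy price is antitone in `β`): one anchor
certificate and two far caps word the cell over the whole temperature range `T ≤ 1/β` at the price
`(16/π²)·gap + T·s_max(n)` (against `(32/π²)·gap` for `forall_sectorGibbsLimit_tPrime_box_of_forall_cap_kinematic`).
The `T > 0` twin of `forall_groundState_tPrime_cell_of_forall_cap_outerCaps_kinematic`.
[cite: WangEtAl2024, §III] [cite: Israel1979, Lemma II.3.1] [cite: LiebLoss1993, §8, Theorem 8.2] -/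
theorem forall_sectorGibbsLimit_tPrime_cell_of_forall_cap_outerCaps_kinematic (t : ℝ) {s₁ s₂ s₀ : ℝ}
    {U : ℝ} (hU : 0 ≤ U) {n : ℝ} (hn0 : 0 ≤ n) (hn2 : n < 2) {β : ℝ} (hβ : 0 < β)
    {R₁ R₂ u : ℝ}
    (hR₁ : energyDensityTT' t s₁ U n ≤ R₁) (hR₂ : energyDensityTT' t s₂ U n ≤ R₂)
    (hu : max (R₁ + 16 / Real.pi ^ 2 * (s₀ - s₁)) (R₂ + 16 / Real.pi ^ 2 * (s₂ - s₀)) +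
      2 * Real.binEntropy (n / 2) / β ≤ u)
    {P : InfVolFermionState 2 → Prop}
    (hP : ∀ (ω : InfVolFermionState 2) (m : ℕ → ℕ) (p : ∀ L, Fin (m L) → ℝ)
      (ψ : ∀ L, Fin (m L) → Fock (Orb (FermionTorus 2 L))) (Ls : ℕ → ℕ),
      Tendsto Ls atTop atTop → (∀ L i, 0 ≤ p L i) → (∀ L, ∑ i, p L i = 1) →
      (∀ L i, IsNParticle (rectN n L) (ψ L i)) → (∀ L i, star (ψ L i) ⬝ᵥ ψ L i = 1) →
      ω.IsTorusLimitOfMixture m p ψ Ls →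
      ω.meanEnergy (hubbardTTPrimeFermionInteraction t s₀ U) 1 ≤ u → P ω)
    {s : ℝ} (hs : s ∈ Set.Icc s₁ s₂) {β' : ℝ} (hβ' : β ≤ β')
    {ω : InfVolFermionState 2} {Ls : ℕ → ℕ}
    (h : ω.IsTorusLimitOfMixture (sectorGibbsCount n) (fun L => sectorGibbsWeightTT' β' t s U n L)
      (fun L => sectorGibbsVectorTT' t s U n L) Ls) (hLs : Tendsto Ls atTop atTop) : P ω := by
  have hβ'0 : 0 < β' := hβ.trans_le hβ'
  refine hP ω (sectorGibbsCount n) _ _ Ls hLs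
    (fun L i => sectorGibbsWeightTT'_nonneg β' t s U n L i)
    (fun L => sum_sectorGibbsWeightTT' β' t s U hn0 hn2.le L)
    (fun L i => isNParticle_sectorGibbsVectorTT' t s U n L i)
    (fun L i => star_sectorGibbsVectorTT'_dotProduct_self t s U n L i) h ?_
  have hwin := h.meanEnergy_anchor_le_of_outerCaps_kinematic_of_sectorGibbs t (s₀ := s₀) hs hU hn0 hn2
    hβ'0 hR₁ hR₂ hLs
  have hH : 0 ≤ 2 * Real.binEntropy (n / 2) :=
    mul_nonneg zero_le_two (Real.binEntropy_nonneg (by linarith) (by linarith))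
  have hent : 2 * Real.binEntropy (n / 2) / β' ≤ 2 * Real.binEntropy (n / 2) / β :=
    div_le_div_of_nonneg_left hH hβ hβ'
  linarith

/-- **BOX ⇒ WORD on `[s₁, s₀] × (T ≤ 1/β)` from ONE left cap (kinematic)**: if
`R₁ + (16/π²)(s₀ − s₁) + 2H_b(n/2)/β ≤ u`, the anchor's thermal cap-class property `P` holds for every
thermal torus limit at `(β', s)`, `s ∈ [s₁, s₀]`, `β' ≥ β`.
[cite: WangEtAl2024, §III] [cite: Israel1979, Lemma II.3.1] [cite: LiebLoss1993, §8, Theorem 8.2] -/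
theorem forall_sectorGibbsLimit_tPrime_cell_of_forall_cap_leftCap_kinematic (t : ℝ) {s₁ s₀ : ℝ}
    {U : ℝ} (hU : 0 ≤ U) {n : ℝ} (hn0 : 0 ≤ n) (hn2 : n < 2) {β : ℝ} (hβ : 0 < β)
    {R₁ u : ℝ} (hR₁ : energyDensityTT' t s₁ U n ≤ R₁)
    (hu : R₁ + 16 / Real.pi ^ 2 * (s₀ - s₁) + 2 * Real.binEntropy (n / 2) / β ≤ u)
    {P : InfVolFermionState 2 → Prop}
    (hP : ∀ (ω : InfVolFermionState 2) (m : ℕ → ℕ) (p : ∀ L, Fin (m L) → ℝ)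
      (ψ : ∀ L, Fin (m L) → Fock (Orb (FermionTorus 2 L))) (Ls : ℕ → ℕ),
      Tendsto Ls atTop atTop → (∀ L i, 0 ≤ p L i) → (∀ L, ∑ i, p L i = 1) →
      (∀ L i, IsNParticle (rectN n L) (ψ L i)) → (∀ L i, star (ψ L i) ⬝ᵥ ψ L i = 1) →
      ω.IsTorusLimitOfMixture m p ψ Ls →
      ω.meanEnergy (hubbardTTPrimeFermionInteraction t s₀ U) 1 ≤ u → P ω)
    {s : ℝ} (hs : s ∈ Set.Icc s₁ s₀) {β' : ℝ} (hβ' : β ≤ β')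
    {ω : InfVolFermionState 2} {Ls : ℕ → ℕ}
    (h : ω.IsTorusLimitOfMixture (sectorGibbsCount n) (fun L => sectorGibbsWeightTT' β' t s U n L)
      (fun L => sectorGibbsVectorTT' t s U n L) Ls) (hLs : Tendsto Ls atTop atTop) : P ω := by
  have hβ'0 : 0 < β' := hβ.trans_le hβ'
  refine hP ω (sectorGibbsCount n) _ _ Ls hLs
    (fun L i => sectorGibbsWeightTT'_nonneg β' t s U n L i)
    (fun L => sum_sectorGibbsWeightTT' β' t s U hn0 hn2.le L)
    (fun L i => isNParticle_sectorGibbsVectorTT' t s U n L i)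
    (fun L i => star_sectorGibbsVectorTT'_dotProduct_self t s U n L i) h ?_
  have hwin := h.meanEnergy_anchor_le_of_leftCap_kinematic_of_sectorGibbs t hs.1 hs.2 hU hn0 hn2 hβ'0
    hR₁ hLs
  have hH : 0 ≤ 2 * Real.binEntropy (n / 2) :=
    mul_nonneg zero_le_two (Real.binEntropy_nonneg (by linarith) (by linarith))
  have hent : 2 * Real.binEntropy (n / 2) / β' ≤ 2 * Real.binEntropy (n / 2) / β :=
    div_le_div_of_nonneg_left hH hβ hβ'
  linarith

/-- **BOX ⇒ WORD on `[s₀, s₂] × (T ≤ 1/β)` from ONE right cap (kinematic)**: if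
`R₂ + (16/π²)(s₂ − s₀) + 2H_b(n/2)/β ≤ u`, the anchor's thermal cap-class property `P` holds for every
thermal torus limit at `(β', s)`, `s ∈ [s₀, s₂]`, `β' ≥ β`.
[cite: WangEtAl2024, §III] [cite: Israel1979, Lemma II.3.1] [cite: LiebLoss1993, §8, Theorem 8.2] -/
theorem forall_sectorGibbsLimit_tPrime_cell_of_forall_cap_rightCap_kinematic (t : ℝ) {s₀ s₂ : ℝ}
    {U : ℝ} (hU : 0 ≤ U) {n : ℝ} (hn0 : 0 ≤ n) (hn2 : n < 2) {β : ℝ} (hβ : 0 < β)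
    {R₂ u : ℝ} (hR₂ : energyDensityTT' t s₂ U n ≤ R₂)
    (hu : R₂ + 16 / Real.pi ^ 2 * (s₂ - s₀) + 2 * Real.binEntropy (n / 2) / β ≤ u)
    {P : InfVolFermionState 2 → Prop}
    (hP : ∀ (ω : InfVolFermionState 2) (m : ℕ → ℕ) (p : ∀ L, Fin (m L) → ℝ)
      (ψ : ∀ L, Fin (m L) → Fock (Orb (FermionTorus 2 L))) (Ls : ℕ → ℕ),
      Tendsto Ls atTop atTop → (∀ L i, 0 ≤ p L i) → (∀ L, ∑ i, p L i = 1) →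
      (∀ L i, IsNParticle (rectN n L) (ψ L i)) → (∀ L i, star (ψ L i) ⬝ᵥ ψ L i = 1) →
      ω.IsTorusLimitOfMixture m p ψ Ls →
      ω.meanEnergy (hubbardTTPrimeFermionInteraction t s₀ U) 1 ≤ u → P ω)
    {s : ℝ} (hs : s ∈ Set.Icc s₀ s₂) {β' : ℝ} (hβ' : β ≤ β')
    {ω : InfVolFermionState 2} {Ls : ℕ → ℕ}
    (h : ω.IsTorusLimitOfMixture (sectorGibbsCount n) (fun L => sectorGibbsWeightTT' β' t s U n L)
      (fun L => sectorGibbsVectorTT' t s U n L) Ls) (hLs : Tendsto Ls atTop atTop) : P ω := by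
  have hβ'0 : 0 < β' := hβ.trans_le hβ'
  refine hP ω (sectorGibbsCount n) _ _ Ls hLs
    (fun L i => sectorGibbsWeightTT'_nonneg β' t s U n L i)
    (fun L => sum_sectorGibbsWeightTT' β' t s U hn0 hn2.le L)
    (fun L i => isNParticle_sectorGibbsVectorTT' t s U n L i)
    (fun L i => star_sectorGibbsVectorTT'_dotProduct_self t s U n L i) h ?_
  have hwin := h.meanEnergy_anchor_le_of_rightCap_kinematic_of_sectorGibbs t hs.1 hs.2 hU hn0 hn2
    hβ'0 hR₂ hLs
  have hH : 0 ≤ 2 * Real.binEntropy (n / 2) :=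
    mul_nonneg zero_le_two (Real.binEntropy_nonneg (by linarith) (by linarith))
  have hent : 2 * Real.binEntropy (n / 2) / β' ≤ 2 * Real.binEntropy (n / 2) / β :=
    div_le_div_of_nonneg_left hH hβ hβ'
  linarith

/-! ### §4 Cap-class WORDS with explicit cap slack, priced by the far column at `T > 0`
(the thermal twins of `IsTorusLimitOf.sub_mul_le_word_of_forall_capSlack_{left,right,outer}Column(s)`) -/

/-- **A thermal cap-class word with explicit slack, LEFT column (fixed `β`).** Cell `s₁ ≤ s ≤ s₀`, a cap
`R₁`, a ground-state ceiling word `A₁` and a thermal ceiling word `A₁'` at the column `s₁`; a real word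
certified at the anchor `s₀` for the thermal cap class with its cap slack explicit,
`c + κ·(u₀ − e_{Φ(t,s₀,U)}(ω)) ≤ f ω` (`κ ≥ 0`). Then every thermal torus limit `ω` at `(β, s)` has
`c − κ·(R₁ + (s₀ − s₁)·max A₁ A₁' + 2H_b(n/2)/β − u₀) ≤ f ω` — uniform in `s`.
[cite: WangEtAl2024, §III] [cite: Israel1979, Lemma II.3.1] [cite: Lieb1973, §V (5.2)–(5.4)] -/
theorem IsTorusLimitOfMixture.sub_mul_le_word_of_forall_capSlack_leftColumn_of_sectorGibbs (t : ℝ)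
    {s₁ s s₀ : ℝ} (hs₁ : s₁ ≤ s) (hs₀ : s ≤ s₀) {U : ℝ} (hU : 0 ≤ U) {n : ℝ} (hn0 : 0 ≤ n)
    (hn2 : n < 2) {β : ℝ} (hβ : 0 < β) {R₁ A₁ A₁' u₀ κ c : ℝ} (hκ : 0 ≤ κ)
    (hR₁ : energyDensityTT' t s₁ U n ≤ R₁)
    (hA₁ : ∀ (ω₁ : InfVolFermionState 2) (Ls₁ : ℕ → ℕ) (ψ₁ : ∀ L, Fock (Orb (FermionTorus 2 L))),
      Tendsto Ls₁ atTop atTop →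
      (∀ j, IsGroundStateInSector (hubbardTorusTT' (Ls₁ j) t s₁ U) (rectN n (Ls₁ j)) 0 (ψ₁ (Ls₁ j))) →
      (∀ j, star (ψ₁ (Ls₁ j)) ⬝ᵥ ψ₁ (Ls₁ j) = 1) → ω₁.IsTorusLimitOf ψ₁ Ls₁ →
      ω₁.meanEnergy (hubbardTTPrimeFermionInteraction 0 1 0) 1 ≤ A₁)
    (hA₁' : ∀ (ω₁ : InfVolFermionState 2) (Ls₁ : ℕ → ℕ), Tendsto Ls₁ atTop atTop →
      ω₁.IsTorusLimitOfMixture (sectorGibbsCount n) (fun L => sectorGibbsWeightTT' β t s₁ U n L)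
        (fun L => sectorGibbsVectorTT' t s₁ U n L) Ls₁ →
      ω₁.meanEnergy (hubbardTTPrimeFermionInteraction 0 1 0) 1 ≤ A₁')
    {f : InfVolFermionState 2 → ℝ}
    (hf : ∀ (ω : InfVolFermionState 2) (m : ℕ → ℕ) (p : ∀ L, Fin (m L) → ℝ)
      (ψ : ∀ L, Fin (m L) → Fock (Orb (FermionTorus 2 L))) (Ls : ℕ → ℕ),
      Tendsto Ls atTop atTop → (∀ L i, 0 ≤ p L i) → (∀ L, ∑ i, p L i = 1) →
      (∀ L i, IsNParticle (rectN n L) (ψ L i)) → (∀ L i, star (ψ L i) ⬝ᵥ ψ L i = 1) →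
      ω.IsTorusLimitOfMixture m p ψ Ls →
      c + κ * (u₀ - ω.meanEnergy (hubbardTTPrimeFermionInteraction t s₀ U) 1) ≤ f ω)
    {ω : InfVolFermionState 2} {Ls : ℕ → ℕ}
    (h : ω.IsTorusLimitOfMixture (sectorGibbsCount n) (fun L => sectorGibbsWeightTT' β t s U n L)
      (fun L => sectorGibbsVectorTT' t s U n L) Ls) (hLs : Tendsto Ls atTop atTop) :
    c - κ * (R₁ + (s₀ - s₁) * max A₁ A₁' + 2 * Real.binEntropy (n / 2) / β - u₀) ≤ f ω := by
  have hfω := hf ω (sectorGibbsCount n) _ _ Ls hLs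
    (fun L i => sectorGibbsWeightTT'_nonneg β t s U n L i)
    (fun L => sum_sectorGibbsWeightTT' β t s U hn0 hn2.le L)
    (fun L i => isNParticle_sectorGibbsVectorTT' t s U n L i)
    (fun L i => star_sectorGibbsVectorTT'_dotProduct_self t s U n L i) h
  have hcap := h.meanEnergy_anchor_le_of_leftColumn_of_sectorGibbs t hs₁ hs₀ hU hn0 hn2 hβ hR₁ hA₁
    hA₁' hLs
  have hslack : -(R₁ + (s₀ - s₁) * max A₁ A₁' + 2 * Real.binEntropy (n / 2) / β - u₀) ≤
      u₀ - ω.meanEnergy (hubbardTTPrimeFermionInteraction t s₀ U) 1 := by linarith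
  have hκs := mul_le_mul_of_nonneg_left hslack hκ
  linarith

/-- **A thermal cap-class word with explicit slack, RIGHT column (fixed `β`).** Cell `s₀ ≤ s ≤ s₂`, a cap
`R₂`, a ground-state floor word `B₂` and a thermal floor word `B₂'` at `s₂`; same certified word at the
anchor. Every thermal torus limit `ω` at `(β, s)` has
`c − κ·(R₂ − (s₂ − s₀)·min B₂ B₂' + 2H_b(n/2)/β − u₀) ≤ f ω`.
[cite: WangEtAl2024, §III] [cite: Israel1979, Lemma II.3.1] [cite: Lieb1973, §V (5.2)–(5.4)] -/
theorem IsTorusLimitOfMixture.sub_mul_le_word_of_forall_capSlack_rightColumn_of_sectorGibbs (t : ℝ)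
    {s₀ s s₂ : ℝ} (hs₀ : s₀ ≤ s) (hs₂ : s ≤ s₂) {U : ℝ} (hU : 0 ≤ U) {n : ℝ} (hn0 : 0 ≤ n)
    (hn2 : n < 2) {β : ℝ} (hβ : 0 < β) {R₂ B₂ B₂' u₀ κ c : ℝ} (hκ : 0 ≤ κ)
    (hR₂ : energyDensityTT' t s₂ U n ≤ R₂)
    (hB₂ : ∀ (ω₂ : InfVolFermionState 2) (Ls₂ : ℕ → ℕ) (ψ₂ : ∀ L, Fock (Orb (FermionTorus 2 L))),
      Tendsto Ls₂ atTop atTop →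
      (∀ j, IsGroundStateInSector (hubbardTorusTT' (Ls₂ j) t s₂ U) (rectN n (Ls₂ j)) 0 (ψ₂ (Ls₂ j))) →
      (∀ j, star (ψ₂ (Ls₂ j)) ⬝ᵥ ψ₂ (Ls₂ j) = 1) → ω₂.IsTorusLimitOf ψ₂ Ls₂ →
      B₂ ≤ ω₂.meanEnergy (hubbardTTPrimeFermionInteraction 0 1 0) 1)
    (hB₂' : ∀ (ω₂ : InfVolFermionState 2) (Ls₂ : ℕ → ℕ), Tendsto Ls₂ atTop atTop →
      ω₂.IsTorusLimitOfMixture (sectorGibbsCount n) (fun L => sectorGibbsWeightTT' β t s₂ U n L)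
        (fun L => sectorGibbsVectorTT' t s₂ U n L) Ls₂ →
      B₂' ≤ ω₂.meanEnergy (hubbardTTPrimeFermionInteraction 0 1 0) 1)
    {f : InfVolFermionState 2 → ℝ}
    (hf : ∀ (ω : InfVolFermionState 2) (m : ℕ → ℕ) (p : ∀ L, Fin (m L) → ℝ)
      (ψ : ∀ L, Fin (m L) → Fock (Orb (FermionTorus 2 L))) (Ls : ℕ → ℕ),
      Tendsto Ls atTop atTop → (∀ L i, 0 ≤ p L i) → (∀ L, ∑ i, p L i = 1) →
      (∀ L i, IsNParticle (rectN n L) (ψ L i)) → (∀ L i, star (ψ L i) ⬝ᵥ ψ L i = 1) →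
      ω.IsTorusLimitOfMixture m p ψ Ls →
      c + κ * (u₀ - ω.meanEnergy (hubbardTTPrimeFermionInteraction t s₀ U) 1) ≤ f ω)
    {ω : InfVolFermionState 2} {Ls : ℕ → ℕ}
    (h : ω.IsTorusLimitOfMixture (sectorGibbsCount n) (fun L => sectorGibbsWeightTT' β t s U n L)
      (fun L => sectorGibbsVectorTT' t s U n L) Ls) (hLs : Tendsto Ls atTop atTop) :
    c - κ * (R₂ - (s₂ - s₀) * min B₂ B₂' + 2 * Real.binEntropy (n / 2) / β - u₀) ≤ f ω := by
  have hfω := hf ω (sectorGibbsCount n) _ _ Ls hLs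
    (fun L i => sectorGibbsWeightTT'_nonneg β t s U n L i)
    (fun L => sum_sectorGibbsWeightTT' β t s U hn0 hn2.le L)
    (fun L i => isNParticle_sectorGibbsVectorTT' t s U n L i)
    (fun L i => star_sectorGibbsVectorTT'_dotProduct_self t s U n L i) h
  have hcap := h.meanEnergy_anchor_le_of_rightColumn_of_sectorGibbs t hs₀ hs₂ hU hn0 hn2 hβ hR₂ hB₂
    hB₂' hLs
  have hslack : -(R₂ - (s₂ - s₀) * min B₂ B₂' + 2 * Real.binEntropy (n / 2) / β - u₀) ≤
      u₀ - ω.meanEnergy (hubbardTTPrimeFermionInteraction t s₀ U) 1 := by linarith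
  have hκs := mul_le_mul_of_nonneg_left hslack hκ
  linarith

/-- **A thermal cap-class word with explicit slack, both outer columns (fixed `β`).** Cell `[s₁, s₂] ∋ s`,
any anchor `s₀` (in practice in the cell); caps, ground-state words and thermal words at both columns;
every thermal torus limit `ω` at `(β, s)` has
`c − κ·(max (R₁ + (s₀ − s₁)·max A₁ A₁') (R₂ − (s₂ − s₀)·min B₂ B₂') + 2H_b(n/2)/β − u₀) ≤ f ω`.
[cite: WangEtAl2024, §III] [cite: Israel1979, Lemma II.3.1] [cite: Lieb1973, §V (5.2)–(5.4)] -/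
theorem IsTorusLimitOfMixture.sub_mul_le_word_of_forall_capSlack_outerColumns_of_sectorGibbs (t : ℝ)
    {s₁ s₂ s₀ s : ℝ} (hs : s ∈ Set.Icc s₁ s₂) {U : ℝ} (hU : 0 ≤ U) {n : ℝ} (hn0 : 0 ≤ n)
    (hn2 : n < 2) {β : ℝ} (hβ : 0 < β) {R₁ A₁ A₁' R₂ B₂ B₂' u₀ κ c : ℝ} (hκ : 0 ≤ κ)
    (hR₁ : energyDensityTT' t s₁ U n ≤ R₁) (hR₂ : energyDensityTT' t s₂ U n ≤ R₂)
    (hA₁ : ∀ (ω₁ : InfVolFermionState 2) (Ls₁ : ℕ → ℕ) (ψ₁ : ∀ L, Fock (Orb (FermionTorus 2 L))),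
      Tendsto Ls₁ atTop atTop →
      (∀ j, IsGroundStateInSector (hubbardTorusTT' (Ls₁ j) t s₁ U) (rectN n (Ls₁ j)) 0 (ψ₁ (Ls₁ j))) →
      (∀ j, star (ψ₁ (Ls₁ j)) ⬝ᵥ ψ₁ (Ls₁ j) = 1) → ω₁.IsTorusLimitOf ψ₁ Ls₁ →
      ω₁.meanEnergy (hubbardTTPrimeFermionInteraction 0 1 0) 1 ≤ A₁)
    (hA₁' : ∀ (ω₁ : InfVolFermionState 2) (Ls₁ : ℕ → ℕ), Tendsto Ls₁ atTop atTop →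
      ω₁.IsTorusLimitOfMixture (sectorGibbsCount n) (fun L => sectorGibbsWeightTT' β t s₁ U n L)
        (fun L => sectorGibbsVectorTT' t s₁ U n L) Ls₁ →
      ω₁.meanEnergy (hubbardTTPrimeFermionInteraction 0 1 0) 1 ≤ A₁')
    (hB₂ : ∀ (ω₂ : InfVolFermionState 2) (Ls₂ : ℕ → ℕ) (ψ₂ : ∀ L, Fock (Orb (FermionTorus 2 L))),
      Tendsto Ls₂ atTop atTop →
      (∀ j, IsGroundStateInSector (hubbardTorusTT' (Ls₂ j) t s₂ U) (rectN n (Ls₂ j)) 0 (ψ₂ (Ls₂ j))) →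
      (∀ j, star (ψ₂ (Ls₂ j)) ⬝ᵥ ψ₂ (Ls₂ j) = 1) → ω₂.IsTorusLimitOf ψ₂ Ls₂ →
      B₂ ≤ ω₂.meanEnergy (hubbardTTPrimeFermionInteraction 0 1 0) 1)
    (hB₂' : ∀ (ω₂ : InfVolFermionState 2) (Ls₂ : ℕ → ℕ), Tendsto Ls₂ atTop atTop →
      ω₂.IsTorusLimitOfMixture (sectorGibbsCount n) (fun L => sectorGibbsWeightTT' β t s₂ U n L)
        (fun L => sectorGibbsVectorTT' t s₂ U n L) Ls₂ →
      B₂' ≤ ω₂.meanEnergy (hubbardTTPrimeFermionInteraction 0 1 0) 1)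
    {f : InfVolFermionState 2 → ℝ}
    (hf : ∀ (ω : InfVolFermionState 2) (m : ℕ → ℕ) (p : ∀ L, Fin (m L) → ℝ)
      (ψ : ∀ L, Fin (m L) → Fock (Orb (FermionTorus 2 L))) (Ls : ℕ → ℕ),
      Tendsto Ls atTop atTop → (∀ L i, 0 ≤ p L i) → (∀ L, ∑ i, p L i = 1) →
      (∀ L i, IsNParticle (rectN n L) (ψ L i)) → (∀ L i, star (ψ L i) ⬝ᵥ ψ L i = 1) →
      ω.IsTorusLimitOfMixture m p ψ Ls →
      c + κ * (u₀ - ω.meanEnergy (hubbardTTPrimeFermionInteraction t s₀ U) 1) ≤ f ω)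
    {ω : InfVolFermionState 2} {Ls : ℕ → ℕ}
    (h : ω.IsTorusLimitOfMixture (sectorGibbsCount n) (fun L => sectorGibbsWeightTT' β t s U n L)
      (fun L => sectorGibbsVectorTT' t s U n L) Ls) (hLs : Tendsto Ls atTop atTop) :
    c - κ * (max (R₁ + (s₀ - s₁) * max A₁ A₁') (R₂ - (s₂ - s₀) * min B₂ B₂') +
      2 * Real.binEntropy (n / 2) / β - u₀) ≤ f ω := by
  have hfω := hf ω (sectorGibbsCount n) _ _ Ls hLs
    (fun L i => sectorGibbsWeightTT'_nonneg β t s U n L i)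
    (fun L => sum_sectorGibbsWeightTT' β t s U hn0 hn2.le L)
    (fun L i => isNParticle_sectorGibbsVectorTT' t s U n L i)
    (fun L i => star_sectorGibbsVectorTT'_dotProduct_self t s U n L i) h
  have hcap := h.meanEnergy_anchor_le_of_outerColumns_of_sectorGibbs t (s₀ := s₀) hs hU hn0 hn2 hβ
    hR₁ hR₂ hA₁ hA₁' hB₂ hB₂' hLs
  have hslack : -(max (R₁ + (s₀ - s₁) * max A₁ A₁') (R₂ - (s₂ - s₀) * min B₂ B₂') +
      2 * Real.binEntropy (n / 2) / β - u₀) ≤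
      u₀ - ω.meanEnergy (hubbardTTPrimeFermionInteraction t s₀ U) 1 := by linarith
  have hκs := mul_le_mul_of_nonneg_left hslack hκ
  linarith

/-- **A thermal cap-class word with explicit slack on `(cell) × (T ≤ 1/β)`, word-free (two outer caps,
kinematic row).** Caps `R₁`, `R₂` at the columns, any anchor `s₀`; every thermal torus limit `ω` at
`(β', s)`, `s ∈ [s₁, s₂]`, `β' ≥ β`, has
`c − κ·(max (R₁ + (16/π²)(s₀ − s₁)) (R₂ + (16/π²)(s₂ − s₀)) + 2H_b(n/2)/β − u₀) ≤ f ω` — the certified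
word is LIPSCHITZ in the cell data with constant `κ·16/π²` per unit of `t'` and `κ·s_max(n)` per unit of
`T`. [cite: WangEtAl2024, §III] [cite: Israel1979, Lemma II.3.1] [cite: LiebLoss1993, §8, Theorem 8.2] -/
theorem IsTorusLimitOfMixture.sub_mul_le_word_of_forall_capSlack_outerCaps_kinematic_of_sectorGibbs
    (t : ℝ) {s₁ s₂ s₀ s : ℝ} (hs : s ∈ Set.Icc s₁ s₂) {U : ℝ} (hU : 0 ≤ U) {n : ℝ} (hn0 : 0 ≤ n)
    (hn2 : n < 2) {β : ℝ} (hβ : 0 < β) {R₁ R₂ u₀ κ c : ℝ} (hκ : 0 ≤ κ)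
    (hR₁ : energyDensityTT' t s₁ U n ≤ R₁) (hR₂ : energyDensityTT' t s₂ U n ≤ R₂)
    {f : InfVolFermionState 2 → ℝ}
    (hf : ∀ (ω : InfVolFermionState 2) (m : ℕ → ℕ) (p : ∀ L, Fin (m L) → ℝ)
      (ψ : ∀ L, Fin (m L) → Fock (Orb (FermionTorus 2 L))) (Ls : ℕ → ℕ),
      Tendsto Ls atTop atTop → (∀ L i, 0 ≤ p L i) → (∀ L, ∑ i, p L i = 1) →
      (∀ L i, IsNParticle (rectN n L) (ψ L i)) → (∀ L i, star (ψ L i) ⬝ᵥ ψ L i = 1) →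
      ω.IsTorusLimitOfMixture m p ψ Ls →
      c + κ * (u₀ - ω.meanEnergy (hubbardTTPrimeFermionInteraction t s₀ U) 1) ≤ f ω)
    {β' : ℝ} (hβ' : β ≤ β') {ω : InfVolFermionState 2} {Ls : ℕ → ℕ}
    (h : ω.IsTorusLimitOfMixture (sectorGibbsCount n) (fun L => sectorGibbsWeightTT' β' t s U n L)
      (fun L => sectorGibbsVectorTT' t s U n L) Ls) (hLs : Tendsto Ls atTop atTop) :
    c - κ * (max (R₁ + 16 / Real.pi ^ 2 * (s₀ - s₁)) (R₂ + 16 / Real.pi ^ 2 * (s₂ - s₀)) +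
      2 * Real.binEntropy (n / 2) / β - u₀) ≤ f ω := by
  have hβ'0 : 0 < β' := hβ.trans_le hβ'
  have hfω := hf ω (sectorGibbsCount n) _ _ Ls hLs
    (fun L i => sectorGibbsWeightTT'_nonneg β' t s U n L i)
    (fun L => sum_sectorGibbsWeightTT' β' t s U hn0 hn2.le L)
    (fun L i => isNParticle_sectorGibbsVectorTT' t s U n L i)
    (fun L i => star_sectorGibbsVectorTT'_dotProduct_self t s U n L i) h
  have hcap := h.meanEnergy_anchor_le_of_outerCaps_kinematic_of_sectorGibbs t (s₀ := s₀) hs hU hn0 hn2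
    hβ'0 hR₁ hR₂ hLs
  have hH : 0 ≤ 2 * Real.binEntropy (n / 2) :=
    mul_nonneg zero_le_two (Real.binEntropy_nonneg (by linarith) (by linarith))
  have hent : 2 * Real.binEntropy (n / 2) / β' ≤ 2 * Real.binEntropy (n / 2) / β :=
    div_le_div_of_nonneg_left hH hβ hβ'
  have hslack : -(max (R₁ + 16 / Real.pi ^ 2 * (s₀ - s₁)) (R₂ + 16 / Real.pi ^ 2 * (s₂ - s₀)) +
      2 * Real.binEntropy (n / 2) / β - u₀) ≤
      u₀ - ω.meanEnergy (hubbardTTPrimeFermionInteraction t s₀ U) 1 := by linarith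
  have hκs := mul_le_mul_of_nonneg_left hslack hκ
  linarith

end InfVolFermionState

end Literature.MathematicalPhysics.QuantumLattice

end
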